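import Summits.BirchSwinnertonDyer.BirchSwinnertonDyer.Theorems.BiquadraticEisensteinDescentEisensteinHeartFlatCMInertBadKPrimeKatzTypeInstantiation
import Summits.BirchSwinnertonDyer.BirchSwinnertonDyer.Theorems.BiquadraticEisensteinDescentEisensteinHeartFlatCMInertBadKPrimeFrameCMSubfield
import HarnessLib

set_option linter.dupNamespace false -- `Summit.BirchSwinnertonDyer.BirchSwinnertonDyer.Theorems.…` (summit = sub)
set_option autoImplicit false

/-!
# Crux `EisensteinHeartFlatCMInertBadKPrime` (stmt-BirchSwinnertonDyer-21341), line `hsieh-lambda`, layer 2 (V2) —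
# (T) and (C) of the V2 socket AT THE FRAME `K₁ := ℚ⟮x⟯ ⊆ L`: no `K₁`-binder left

Route `BiquadraticEisensteinDescent` (cell `pub/bsd-wall`, width seat `bsd-wall-cm-bed-w1`; lead `bsd-wall-cm-bed-p1`).
THEOREMS ONLY (no definition, no named fact, no `sorry`); supports stmt-BirchSwinnertonDyer-21341 as a helper; nothing about the
crux's input (stub `V4`) or any case of BSD is asserted. One-call composition of `…KatzTypeInstantiation.exists_hT_hcont` (the
socket binders `hT`, `hcont` for `lam := ψ.compRelNorm L * ‖·‖_L`, granted an abstract CM field `K₁ ⊆ L` with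
`IsImaginaryQuadratic K₁`, `[IsGalois K₁ L]`, `∃ y ∈ K₁ ∖ K′`) with `…FrameCMSubfield` (`K₁ := ℚ⟮x⟯`, `x² = d < 0`, `x ∉ K′`:
`isImaginaryQuadratic_adjoin`, `isGalois_adjoin_top`, `exists_not_mem_range`). What the lead supplies: the Heegner field `K = K′`
(imaginary quadratic), `L ⊇ K′` with `[L : K′] = 2`, `x ∈ L` with `x² = d < 0`, `x ∉ K′` (`…BiquadraticExists`, `…BiquadraticPrimes`),
`[IsCMField L]` (`…BiquadraticCMField.isCMField`), the `p`-adic CM type `Σ_p` (`…BiquadraticCMType.isPAdicCMType_singleton`) with its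
orientation `hSig` (`…SigmaOrientation.inSigma_singleton_iff`), and a Hecke character `ψ` of `ℚ⟮x⟯` of infinity type `(1, 0)`
(Deuring's fact at `K₁ = ℚ⟮x⟯`, `…FrameCMSubfield.isCMFieldOfJ_adjoin`).

References: [Hsieh2014mu] §1.1, §4.1; [Weil1956] §1; [TateThesis1967] Thm. 4.4.1.
-/

noncomputable section

open scoped Classical Topology NumberField IntermediateField
open NumberField IsDedekindDomain Module NumberField.InfinitePlace IntermediateField

namespace Summit.BirchSwinnertonDyer.BirchSwinnertonDyer.Theorems.BiquadraticEisensteinDescentEisensteinHeartFlatCMInertBadKPrimeKatzTypeAtFrame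

open Literature.NumberTheory.EllipticCurves Literature.NumberTheory.GaloisRepresentations
open Summit.BirchSwinnertonDyer.BirchSwinnertonDyer.Theorems.BiquadraticEisensteinDescentEisensteinHeartFlatCMInertBadKPrimeKatzTypeInstantiation
open Summit.BirchSwinnertonDyer.BirchSwinnertonDyer.Theorems.BiquadraticEisensteinDescentEisensteinHeartFlatCMInertBadKPrimeFrameCMSubfield

variable {K L : Type} [Field K] [NumberField K] [Field L] [NumberField L] [Algebra K L]

/-- **(T) and (C) of the V2 socket at the frame `K₁ = ℚ⟮x⟯`.** For the Heegner field `K` (imaginary quadratic), `L ⊇ K` with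
`[L : K] = 2` a CM field, `x ∈ L` with `x² = d < 0` and `x ∉ K`, a `p`-adic CM type `Σ_p` of `L` oriented by
`KatzCM.InSigma ι Σ_p σ ↔ σ|_K = σ̄_v`, and a Hecke character `ψ` of `ℚ⟮x⟯` of infinity type `(1, 0)`: there are `w₁ ≠ w₂`
exhausting the infinite places of `L` such that, for every `χ` of `K` of type `(n, −n)` (`n ≥ 1`; the unramifiedness binder is
carried), `(ψ.compRelNorm L * ‖·‖_L) * χ.compRelNorm L` has Katz type `k = 1`, `κ_n = fun w ↦ if w = w₁ then n else n − 1` AND an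
entire Hecke `L`-function — literally the socket's `hT` and `hcont` for `lam := ψ.compRelNorm L * HeckeCharacter.normCharacter L`
(base change along `ℚ⟮x⟯ ⊆ L`, Galois by `…FrameCMSubfield.isGalois_adjoin_top`). [cite: Hsieh2014mu, §4.1 (interpolation range
`kΣ + κ(1 − c)`, `k ≥ 1`, `κ ≥ 0`)] [cite: Weil1956, §1] [cite: TateThesis1967, Thm. 4.4.1] -/
theorem exists_hT_hcont_adjoin (hK : IsImaginaryQuadratic K) [IsCMField L] [IsGalois K L] (h2 : finrank K L = 2)
    {x : L} {d : ℤ}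
    (hx : x ^ 2 = (d : L)) (hd : d < 0) (hxK : x ∉ Set.range (algebraMap K L)) {p : ℕ} [Fact p.Prime]
    {ι : PadicAlgCl p ≃+* ℂ} {Sp : Finset (HeightOneSpectrum (𝓞 L))} (hSp : KatzCM.IsPAdicCMType p Sp) {v : InfinitePlace K}
    (hSig : ∀ σ : L →+* ℂ, KatzCM.InSigma ι Sp σ ↔ σ.comp (algebraMap K L) = ComplexEmbedding.conjugate v.embedding)
    [IsGalois ℚ⟮x⟯ L] {ψ : HeckeCharacter ℚ⟮x⟯} (hψ : ψ.HasInfinityType (fun _ ↦ 1) (fun _ ↦ 0)) :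
    ∃ w₁ w₂ : InfinitePlace L, w₁ ≠ w₂ ∧ (∀ w : InfinitePlace L, w = w₁ ∨ w = w₂) ∧
      (∀ (χ : HeckeCharacter K) (n : ℕ), 0 < n → (∀ v : HeightOneSpectrum (𝓞 K), χ.IsUnramifiedAt v) →
        χ.HasInfinityType (fun _ ↦ (n : ℤ)) (fun _ ↦ -(n : ℤ)) →
        KatzCM.HasKatzType ι Sp (ψ.compRelNorm L * HeckeCharacter.normCharacter L * χ.compRelNorm L) 1
          (fun w ↦ if w = w₁ then n else n - 1)) ∧
      ∀ (χ : HeckeCharacter K) (n : ℕ), 0 < n → (∀ v : HeightOneSpectrum (𝓞 K), χ.IsUnramifiedAt v) →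
        χ.HasInfinityType (fun _ ↦ (n : ℤ)) (fun _ ↦ -(n : ℤ)) →
        LFunction.HasEntireContinuation
          (heckeLFunction (ψ.compRelNorm L * HeckeCharacter.normCharacter L * χ.compRelNorm L)) :=
  exists_hT_hcont hK (isImaginaryQuadratic_adjoin hx hd (not_mem_range_rat hxK)) h2 (exists_not_mem_range hxK) hSp hSig hψ

end Summit.BirchSwinnertonDyer.BirchSwinnertonDyer.Theorems.BiquadraticEisensteinDescentEisensteinHeartFlatCMInertBadKPrimeKatzTypeAtFrame

end
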